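import Summits.RiemannHypothesis.RiemannHypothesis.Theorems.WeilGroundStateGroundStatesConvergeToXiMellinByParts
import Summits.RiemannHypothesis.RiemannHypothesis.Theorems.WeilGroundStateGroundStatesConvergeToXiCutoff
import Literature.NumberTheory.LFunctions.WeilExplicit
import Literature.NumberTheory.LFunctions.WeilZeroSum
import Literature.NumberTheory.LFunctions.ZetaZeroReciprocalSum
import Literature.Analysis.Calculus.SmoothCutoff
import HarnessLib

/-!
# `WeilGroundState.GroundStatesConvergeToXi` — zero side of the explicit formula under plateau truncation
(crux item stmt-RiemannHypothesis-1527, route route-RiemannHypothesis-WeilGroundState; line `Sketch`,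
stub `stub_zeroSide_truncation` (W12a); `--supports`)

Test functions of the EXPONENTIAL WEIL CLASS: `f : ℝ → ℂ` smooth with
`‖f‖, ‖f'‖, ‖f''‖ ≤ C e^{-b₀|t|}`, `b₀ > 1/2`.  Plateau truncation `f_R = f · χ_R`
(`χ_R = Literature.Analysis.Calculus.cutoff R`: `= 1` on `|t| ≤ R − 1`, `= 0` on `|t| ≥ R`).

* `Σ_ρ ‖m(ρ) f̂(ρ)‖ < ∞` over the non-trivial zeros: `‖f̂(ρ)‖ ≤ 2(τ₀ + τ₂)/(1 + γ²)` in the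
  closed strip by the no-compact-support integration by parts `norm_weilMellin_le_of_two_derivs`
  (`τ₀ = ∫‖f‖e^{|t|/2}`, `τ₂ = ∫‖f''‖e^{|t|/2}`, finite since `b₀ > 1/2`), and
  `Σ_ρ m(ρ)/(1 + γ²) < ∞` (`ZetaZeroSum.summable_zeroOrder_div_one_add_sq`).
* `Σ'_ρ m(ρ) f̂_R(ρ) → Σ'_ρ m(ρ) f̂(ρ)` as `R → ∞`: with `h_R = f − f_R = f (1 − χ_R)`,
  `‖ĥ_R(ρ)‖ ≤ 2(τ₀(R) + τ₂(R))/(1 + γ²)` and the weighted tail norms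
  `τ₀(R) = ∫‖h_R‖e^{|t|/2}`, `τ₂(R) = ∫‖h_R''‖e^{|t|/2}` tend to `0` by dominated convergence
  (the integrands vanish on the plateau `|t| < R − 1` and are dominated by a fixed multiple of
  `e^{-(b₀ - 1/2)|t|}`, the derivatives of `χ_R` being bounded uniformly in `R`).

No new definitions; no named fact is used.
-/

noncomputable section

set_option linter.dupNamespace false

open scoped Topology Real
open Filter Set MeasureTheory Complex

namespace Summit.RiemannHypothesis.RiemannHypothesis.Theorems.GroundStatesConvergeToXi

open Literature.NumberTheory.LFunctions

/-! ## Weighted integrability in the exponential class -/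

/-- `e^{-b₀|t|} e^{|t|/2}` is integrable on `ℝ` for `b₀ > 1/2`. [folklore] -/
theorem zsTrunc_integrable_exp_weight {b₀ : ℝ} (hb : 1 / 2 < b₀) :
    Integrable fun t : ℝ => Real.exp (-(b₀ * |t|)) * Real.exp (|t| / 2) := by
  have hb' : 0 < b₀ - 1 / 2 := sub_pos.2 hb
  have hIoi : IntegrableOn (fun t : ℝ => Real.exp (-(b₀ - 1 / 2) * |t|)) (Ioi 0) := by
    refine (exp_neg_integrableOn_Ioi 0 hb').congr_fun (fun t ht => ?_) measurableSet_Ioi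
    rw [abs_of_pos (mem_Ioi.1 ht)]
  have hIic : IntegrableOn (fun t : ℝ => Real.exp (-(b₀ - 1 / 2) * |t|)) (Iic 0) := by
    rw [← Measure.map_neg_eq_self (volume : Measure ℝ)]
    let m : MeasurableEmbedding fun x : ℝ => -x := (Homeomorph.neg ℝ).measurableEmbedding
    rw [m.integrableOn_map_iff]
    simp_rw [Function.comp_def, abs_neg, neg_preimage, neg_Iic, neg_zero]
    exact Iff.mpr integrableOn_Ici_iff_integrableOn_Ioi hIoi
  have h := hIic.union hIoi
  rw [Iic_union_Ioi, integrableOn_univ] at h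
  refine h.congr (Eventually.of_forall fun t => ?_)
  simp only [← Real.exp_add]
  congr 1
  ring

/-- For continuous `g` with `‖g(t)‖ ≤ K e^{-b₀|t|}` (`b₀ > 1/2`) and `0 ≤ Re s ≤ 1`, the Mellin
integrand `g(t) e^{(s-1/2)t}` is integrable on `ℝ`. [folklore] -/
theorem zsTrunc_integrable_mul_cexp {g : ℝ → ℂ} (hg : Continuous g) {K b₀ : ℝ} (hb : 1 / 2 < b₀)
    (hK : ∀ t, ‖g t‖ ≤ K * Real.exp (-(b₀ * |t|))) {s : ℂ} (hs0 : 0 ≤ s.re) (hs1 : s.re ≤ 1) :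
    Integrable fun t : ℝ => g t * cexp ((s - 1 / 2) * t) := by
  refine (((zsTrunc_integrable_exp_weight hb).const_mul K)).mono' (by fun_prop)
    (ae_of_all _ fun t => ?_)
  rw [norm_mul, Complex.norm_exp]
  have hre : ((s - 1 / 2) * (t : ℂ)).re = (s.re - 1 / 2) * t := by
    simp [sub_re, mul_re]
  rw [hre]
  have h1 : |s.re - 1 / 2| ≤ 1 / 2 := abs_le.2 ⟨by linarith, by linarith⟩
  have h2 : (s.re - 1 / 2) * t ≤ |t| / 2 := by
    calc (s.re - 1 / 2) * t ≤ |(s.re - 1 / 2) * t| := le_abs_self _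
      _ = |s.re - 1 / 2| * |t| := abs_mul _ _
      _ ≤ 1 / 2 * |t| := mul_le_mul_of_nonneg_right h1 (abs_nonneg _)
      _ = |t| / 2 := by ring
  calc ‖g t‖ * Real.exp ((s.re - 1 / 2) * t) ≤ K * Real.exp (-(b₀ * |t|)) * Real.exp (|t| / 2) :=
        mul_le_mul (hK t) (Real.exp_le_exp.2 h2) (Real.exp_pos _).le
          ((norm_nonneg _).trans (hK t))
    _ = K * (Real.exp (-(b₀ * |t|)) * Real.exp (|t| / 2)) := by ring

/-- For continuous `g` with `‖g(t)‖ ≤ K e^{-b₀|t|}` (`b₀ > 1/2`), the weighted norm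
`‖g(t)‖ e^{|t|/2}` is integrable on `ℝ`. [folklore] -/
theorem zsTrunc_integrable_norm_mul_exp {g : ℝ → ℂ} (hg : Continuous g) {K b₀ : ℝ} (hb : 1 / 2 < b₀)
    (hK : ∀ t, ‖g t‖ ≤ K * Real.exp (-(b₀ * |t|))) :
    Integrable fun t : ℝ => ‖g t‖ * Real.exp (|t| / 2) := by
  refine (((zsTrunc_integrable_exp_weight hb).const_mul K)).mono' (by fun_prop)
    (ae_of_all _ fun t => ?_)
  rw [Real.norm_eq_abs, abs_mul, abs_norm, abs_of_pos (Real.exp_pos _)]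
  calc ‖g t‖ * Real.exp (|t| / 2) ≤ K * Real.exp (-(b₀ * |t|)) * Real.exp (|t| / 2) :=
        mul_le_mul_of_nonneg_right (hK t) (Real.exp_pos _).le
    _ = K * (Real.exp (-(b₀ * |t|)) * Real.exp (|t| / 2)) := by ring

/-! ## The two-derivative Mellin bound in the exponential class -/

/-- **Mellin decay in the closed strip for the exponential class.** If `g` has derivatives
`g'`, `g''` (the latter continuous) with `‖g‖, ‖g'‖, ‖g''‖ ≤ K e^{-b₀|t|}`, `b₀ > 1/2`, then for
`0 ≤ Re s ≤ 1`: `‖ĝ(s)‖ ≤ 2(∫‖g‖e^{|t|/2} + ∫‖g''‖e^{|t|/2})/(1 + (Im s)²)`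
(`norm_weilMellin_le_of_two_derivs`). [folklore] -/
theorem zsTrunc_norm_weilMellin_le {g g' g'' : ℝ → ℂ} (hd : ∀ t, HasDerivAt g (g' t) t)
    (hd' : ∀ t, HasDerivAt g' (g'' t) t) (hc'' : Continuous g'') {K b₀ : ℝ} (hb : 1 / 2 < b₀)
    (h0 : ∀ t, ‖g t‖ ≤ K * Real.exp (-(b₀ * |t|))) (h1 : ∀ t, ‖g' t‖ ≤ K * Real.exp (-(b₀ * |t|)))
    (h2 : ∀ t, ‖g'' t‖ ≤ K * Real.exp (-(b₀ * |t|))) {s : ℂ} (hs0 : 0 ≤ s.re) (hs1 : s.re ≤ 1) :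
    ‖weilMellin g s‖ ≤ 2 * ((∫ t : ℝ, ‖g t‖ * Real.exp (|t| / 2)) +
      ∫ t : ℝ, ‖g'' t‖ * Real.exp (|t| / 2)) / (1 + s.im ^ 2) := by
  have hc : Continuous g := continuous_iff_continuousAt.2 fun t => (hd t).continuousAt
  have hc' : Continuous g' := continuous_iff_continuousAt.2 fun t => (hd' t).continuousAt
  exact norm_weilMellin_le_of_two_derivs hs0 hs1 hd hd'
    (zsTrunc_integrable_mul_cexp hc hb h0 hs0 hs1) (zsTrunc_integrable_mul_cexp hc' hb h1 hs0 hs1)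
    (zsTrunc_integrable_mul_cexp hc'' hb h2 hs0 hs1) (zsTrunc_integrable_norm_mul_exp hc hb h0)
    (zsTrunc_integrable_norm_mul_exp hc'' hb h2) le_rfl le_rfl


/-- **Summation over the zeros from a strip bound.** If `‖a(s)‖ ≤ A/(1 + (Im s)²)` in the closed
strip, then `Σ_ρ ‖m(ρ) a(ρ)‖` over the non-trivial zeros converges and is at most
`A · Σ_ρ m(ρ)/(1 + γ²)` (`ZetaZeroSum.summable_zeroOrder_div_one_add_sq`, `m(ρ) ≥ 0`). [folklore] -/
theorem zsTrunc_summable_of_le {a : ℂ → ℂ} {A : ℝ}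
    (hA : ∀ s : ℂ, 0 ≤ s.re → s.re ≤ 1 → ‖a s‖ ≤ A / (1 + s.im ^ 2)) :
    Summable (fun ρ : ZetaZeros.riemannZetaNontrivialZeros =>
        ‖(riemannZetaZeroOrder (ρ : ℂ) : ℂ) * a ρ‖) ∧
      ∑' ρ : ZetaZeros.riemannZetaNontrivialZeros,
          ‖(riemannZetaZeroOrder (ρ : ℂ) : ℂ) * a ρ‖ ≤
        A * ∑' ρ : ZetaZeros.riemannZetaNontrivialZeros,
          (riemannZetaZeroOrder (ρ : ℂ) : ℝ) / (1 + (ρ : ℂ).im ^ 2) := by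
  have hZsum : Summable fun ρ : ZetaZeros.riemannZetaNontrivialZeros =>
      (riemannZetaZeroOrder (ρ : ℂ) : ℝ) / (1 + (ρ : ℂ).im ^ 2) :=
    ZetaZeroSum.summable_zeroOrder_div_one_add_sq
  have hterm : ∀ ρ : ZetaZeros.riemannZetaNontrivialZeros,
      ‖(riemannZetaZeroOrder (ρ : ℂ) : ℂ) * a ρ‖ ≤
        A * ((riemannZetaZeroOrder (ρ : ℂ) : ℝ) / (1 + (ρ : ℂ).im ^ 2)) := by
    intro ρ
    have hm : (0 : ℝ) ≤ riemannZetaZeroOrder (ρ : ℂ) := by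
      exact_mod_cast riemannZetaZeroOrder_nonneg (ZetaZeros.riemannZetaNontrivialZeros.ne_one ρ.2)
    rw [norm_mul, Complex.norm_intCast, abs_of_nonneg hm]
    calc (riemannZetaZeroOrder (ρ : ℂ) : ℝ) * ‖a ρ‖
        ≤ (riemannZetaZeroOrder (ρ : ℂ) : ℝ) * (A / (1 + (ρ : ℂ).im ^ 2)) :=
          mul_le_mul_of_nonneg_left (hA ρ (ZetaZeros.riemannZetaNontrivialZeros.re_pos ρ.2).le
            (ZetaZeros.riemannZetaNontrivialZeros.re_lt_one ρ.2).le) hm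
      _ = A * ((riemannZetaZeroOrder (ρ : ℂ) : ℝ) / (1 + (ρ : ℂ).im ^ 2)) := by ring
  have hs : Summable fun ρ : ZetaZeros.riemannZetaNontrivialZeros =>
      ‖(riemannZetaZeroOrder (ρ : ℂ) : ℂ) * a ρ‖ :=
    Summable.of_nonneg_of_le (fun _ => norm_nonneg _) hterm (hZsum.mul_left A)
  exact ⟨hs, (hs.tsum_le_tsum hterm (hZsum.mul_left A)).trans_eq tsum_mul_left⟩

/-! ## Truncation: the tail `h_R = f (1 - χ_R)` and its derivatives -/

section Tail

open Literature.Analysis.Calculus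

/-- `t ↦ 1 − χ_R(t)` (as a complex-valued function) has derivative `−χ_R'(t)`. [folklore] -/
theorem zsTrunc_hasDerivAt_one_sub_cutoff (R t : ℝ) :
    HasDerivAt (fun t : ℝ => ((1 - cutoff R t : ℝ) : ℂ)) ((-deriv (cutoff R) t : ℝ) : ℂ) t := by
  have h : HasDerivAt (cutoff R) (deriv (cutoff R) t) t :=
    (hasDerivAt_cutoff R t).differentiableAt.hasDerivAt
  exact (h.const_sub 1).ofReal_comp

/-- `t ↦ −χ_R'(t)` (as a complex-valued function) has derivative `−χ_R''(t)`. [folklore] -/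
theorem zsTrunc_hasDerivAt_neg_deriv_cutoff (R t : ℝ) :
    HasDerivAt (fun t : ℝ => ((-deriv (cutoff R) t : ℝ) : ℂ))
      ((-deriv (deriv (cutoff R)) t : ℝ) : ℂ) t := by
  have h : HasDerivAt (deriv (cutoff R)) (deriv (deriv (cutoff R)) t) t :=
    (hasDerivAt_deriv_cutoff R t).differentiableAt.hasDerivAt
  exact h.neg.ofReal_comp

/-- `‖1 − χ_R(t)‖ ≤ 1`. [folklore] -/
theorem zsTrunc_norm_one_sub_cutoff_le (R t : ℝ) : ‖((1 - cutoff R t : ℝ) : ℂ)‖ ≤ 1 := by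
  rw [Complex.norm_real, Real.norm_eq_abs]
  have h0 := cutoff_nonneg R t
  have h1 := cutoff_le_one R t
  exact abs_le.2 ⟨by linarith, by linarith⟩

/-- **Weighted tail norms vanish in the limit.** If the `G R : ℝ → ℂ` are continuous, dominated by
`K e^{-b₀|t|}` uniformly in `R` (`b₀ > 1/2`), and vanish on the plateau `|t| < R − 1`, then
`∫ ‖G R t‖ e^{|t|/2} dt → 0` as `R → ∞` (dominated convergence). [folklore] -/
theorem zsTrunc_tendsto_integral_norm_mul_exp {G : ℝ → ℝ → ℂ} (hc : ∀ R, Continuous (G R))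
    {K b₀ : ℝ} (hb : 1 / 2 < b₀) (hK : ∀ R t, ‖G R t‖ ≤ K * Real.exp (-(b₀ * |t|)))
    (hz : ∀ R t, |t| < R - 1 → G R t = 0) :
    Tendsto (fun R : ℝ => ∫ t : ℝ, ‖G R t‖ * Real.exp (|t| / 2)) atTop (𝓝 0) := by
  have h := tendsto_integral_filter_of_dominated_convergence
    (F := fun (R : ℝ) (t : ℝ) => ‖G R t‖ * Real.exp (|t| / 2)) (f := fun _ : ℝ => (0 : ℝ))
    (l := atTop) (μ := volume)
    (fun t : ℝ => K * (Real.exp (-(b₀ * |t|)) * Real.exp (|t| / 2)))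
    (Eventually.of_forall fun R => ?_)
    (Eventually.of_forall fun R => ae_of_all _ fun t => ?_)
    ((zsTrunc_integrable_exp_weight hb).const_mul K) (ae_of_all _ fun t => ?_)
  · simpa using h
  · have hcR := hc R
    exact (hcR.norm.mul (Real.continuous_exp.comp (continuous_abs.div_const 2))).aestronglyMeasurable
  · rw [Real.norm_eq_abs, abs_mul, abs_norm, abs_of_pos (Real.exp_pos _)]
    calc ‖G R t‖ * Real.exp (|t| / 2) ≤ K * Real.exp (-(b₀ * |t|)) * Real.exp (|t| / 2) :=
          mul_le_mul_of_nonneg_right (hK R t) (Real.exp_pos _).le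
      _ = K * (Real.exp (-(b₀ * |t|)) * Real.exp (|t| / 2)) := by ring
  · refine (tendsto_const_nhds (x := (0 : ℝ))).congr' ?_
    filter_upwards [eventually_ge_atTop (|t| + 2)] with R hR
    rw [hz R t (by linarith), norm_zero, zero_mul]

/-- **Additivity of the transform under truncation**: `f̂(s) − (f χ_R)^(s) = (f (1 − χ_R))^(s)`
in the closed strip (both integrands are integrable there). [folklore] -/
theorem zsTrunc_weilMellin_sub {f : ℝ → ℂ} (hfc : Continuous f) {C b₀ : ℝ} (hb : 1 / 2 < b₀)
    (h0 : ∀ t, ‖f t‖ ≤ C * Real.exp (-(b₀ * |t|))) (R : ℝ) {s : ℂ} (hs0 : 0 ≤ s.re)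
    (hs1 : s.re ≤ 1) :
    weilMellin f s - weilMellin (fun t : ℝ => f t * ((cutoff R t : ℝ) : ℂ)) s =
      weilMellin (fun t : ℝ => f t * ((1 - cutoff R t : ℝ) : ℂ)) s := by
  have hcχ : Continuous fun t : ℝ => ((cutoff R t : ℝ) : ℂ) :=
    Complex.continuous_ofReal.comp (contDiff_cutoff R (n := 0)).continuous
  have hb' : ∀ t, ‖f t * ((cutoff R t : ℝ) : ℂ)‖ ≤ C * Real.exp (-(b₀ * |t|)) := by
    intro t
    rw [norm_mul, Complex.norm_real, Real.norm_eq_abs, abs_of_nonneg (cutoff_nonneg R t)]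
    exact (mul_le_of_le_one_right (norm_nonneg _) (cutoff_le_one R t)).trans (h0 t)
  have hc2 : Continuous fun t : ℝ => f t * ((cutoff R t : ℝ) : ℂ) := hfc.mul hcχ
  unfold weilMellin
  rw [← integral_sub (zsTrunc_integrable_mul_cexp hfc hb h0 hs0 hs1)
    (zsTrunc_integrable_mul_cexp hc2 hb hb' hs0 hs1)]
  refine integral_congr_ae (ae_of_all _ fun t => ?_)
  simp only [Complex.ofReal_sub, Complex.ofReal_one]
  ring

/-- **Tail control.** For `f` in the exponential Weil class there is `τ : ℝ → ℝ` with `τ(R) → 0`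
(`R → ∞`) and `‖f̂(s) − (f χ_R)^(s)‖ ≤ τ(R)/(1 + (Im s)²)` throughout the closed strip: indeed
`f̂ − (fχ_R)^ = ĥ_R` with `h_R = f(1 − χ_R)`, `‖ĥ_R(s)‖ ≤ 2(τ₀(R) + τ₂(R))/(1 + (Im s)²)`
(`norm_weilMellin_le_of_two_derivs` with `h_R' = f'(1−χ_R) − fχ_R'`,
`h_R'' = f''(1−χ_R) − 2f'χ_R' − fχ_R''`, all `O(e^{-b₀|t|})` uniformly in `R`), and the weighted
tail norms `τ₀(R) = ∫‖h_R‖e^{|t|/2}`, `τ₂(R) = ∫‖h_R''‖e^{|t|/2}` tend to `0`. [folklore] -/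
theorem zsTrunc_tail_control {f : ℝ → ℂ} {C b₀ : ℝ} (hb : 1 / 2 < b₀)
    (hd : ∀ t, HasDerivAt f (deriv f t) t)
    (hd' : ∀ t, HasDerivAt (deriv f) (deriv (deriv f) t) t) (hc'' : Continuous (deriv (deriv f)))
    (h0 : ∀ t, ‖f t‖ ≤ C * Real.exp (-(b₀ * |t|)))
    (h1 : ∀ t, ‖deriv f t‖ ≤ C * Real.exp (-(b₀ * |t|)))
    (h2 : ∀ t, ‖deriv (deriv f) t‖ ≤ C * Real.exp (-(b₀ * |t|))) :
    ∃ τ : ℝ → ℝ, Tendsto τ atTop (𝓝 0) ∧ ∀ (R : ℝ) (s : ℂ), 0 ≤ s.re → s.re ≤ 1 →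
      ‖weilMellin f s - weilMellin (fun t : ℝ => f t * ((cutoff R t : ℝ) : ℂ)) s‖ ≤
        τ R / (1 + s.im ^ 2) := by
  obtain ⟨D₁, hD₁, hD₁b⟩ := exists_bound_deriv_cutoff
  obtain ⟨D₂, hD₂, hD₂b⟩ := exists_bound_deriv_deriv_cutoff
  have hfc : Continuous f := continuous_iff_continuousAt.2 fun t => (hd t).continuousAt
  have hfc' : Continuous (deriv f) := continuous_iff_continuousAt.2 fun t => (hd' t).continuousAt
  have hC : 0 ≤ C := by
    have h := h0 0
    simp only [abs_zero, mul_zero, neg_zero, Real.exp_zero, mul_one] at h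
    exact (norm_nonneg _).trans h
  have cχ : ∀ R, Continuous (cutoff R) := fun R => (contDiff_cutoff R (n := 0)).continuous
  have cχ' : ∀ R, Continuous (deriv (cutoff R)) := continuous_deriv_cutoff
  have cχ'' : ∀ R, Continuous (deriv (deriv (cutoff R))) := continuous_deriv_deriv_cutoff
  -- the tail `H R = f (1 - χ_R)` and its two derivatives
  set P : ℝ → ℝ → ℂ := fun R t => ((1 - cutoff R t : ℝ) : ℂ) with hP
  set P' : ℝ → ℝ → ℂ := fun R t => ((-deriv (cutoff R) t : ℝ) : ℂ) with hP'
  set P'' : ℝ → ℝ → ℂ := fun R t => ((-deriv (deriv (cutoff R)) t : ℝ) : ℂ) with hP''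
  set H : ℝ → ℝ → ℂ := fun R t => f t * P R t with hH
  set H' : ℝ → ℝ → ℂ := fun R t => deriv f t * P R t + f t * P' R t with hH'
  set H'' : ℝ → ℝ → ℂ := fun R t => (deriv (deriv f) t * P R t + deriv f t * P' R t) +
    (deriv f t * P' R t + f t * P'' R t) with hH''
  have hHd : ∀ R t, HasDerivAt (H R) (H' R t) t := fun R t =>
    (hd t).mul (zsTrunc_hasDerivAt_one_sub_cutoff R t)
  have hHd' : ∀ R t, HasDerivAt (H' R) (H'' R t) t := fun R t =>
    ((hd' t).mul (zsTrunc_hasDerivAt_one_sub_cutoff R t)).add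
      ((hd t).mul (zsTrunc_hasDerivAt_neg_deriv_cutoff R t))
  -- norms of the cutoff factors
  have nP : ∀ R t, ‖P R t‖ ≤ 1 := fun R t => zsTrunc_norm_one_sub_cutoff_le R t
  have nP' : ∀ R t, ‖P' R t‖ ≤ D₁ := fun R t => by
    simp only [hP', Complex.norm_real, Real.norm_eq_abs, abs_neg]
    exact hD₁b R t
  have nP'' : ∀ R t, ‖P'' R t‖ ≤ D₂ := fun R t => by
    simp only [hP'', Complex.norm_real, Real.norm_eq_abs, abs_neg]
    exact hD₂b R t
  -- uniform exponential bounds for `H`, `H'`, `H''`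
  set K : ℝ := (1 + 2 * D₁ + D₂) * C with hK
  have hE : ∀ t, 0 ≤ C * Real.exp (-(b₀ * |t|)) := fun t => by positivity
  have bH : ∀ R t, ‖H R t‖ ≤ K * Real.exp (-(b₀ * |t|)) := by
    intro R t
    have e := hE t
    calc ‖H R t‖ = ‖f t‖ * ‖P R t‖ := norm_mul _ _
      _ ≤ C * Real.exp (-(b₀ * |t|)) * 1 := mul_le_mul (h0 t) (nP R t) (norm_nonneg _) e
      _ ≤ K * Real.exp (-(b₀ * |t|)) := by
          rw [hK]; nlinarith [mul_nonneg hD₁ e, mul_nonneg hD₂ e]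
  have bH' : ∀ R t, ‖H' R t‖ ≤ K * Real.exp (-(b₀ * |t|)) := by
    intro R t
    have e := hE t
    calc ‖H' R t‖ ≤ ‖deriv f t‖ * ‖P R t‖ + ‖f t‖ * ‖P' R t‖ :=
          (norm_add_le _ _).trans (by rw [norm_mul, norm_mul])
      _ ≤ C * Real.exp (-(b₀ * |t|)) * 1 + C * Real.exp (-(b₀ * |t|)) * D₁ :=
          add_le_add (mul_le_mul (h1 t) (nP R t) (norm_nonneg _) e)
            (mul_le_mul (h0 t) (nP' R t) (norm_nonneg _) e)
      _ ≤ K * Real.exp (-(b₀ * |t|)) := by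
          rw [hK]; nlinarith [mul_nonneg hD₁ e, mul_nonneg hD₂ e]
  have bH'' : ∀ R t, ‖H'' R t‖ ≤ K * Real.exp (-(b₀ * |t|)) := by
    intro R t
    have e := hE t
    calc ‖H'' R t‖ ≤ (‖deriv (deriv f) t‖ * ‖P R t‖ + ‖deriv f t‖ * ‖P' R t‖) +
          (‖deriv f t‖ * ‖P' R t‖ + ‖f t‖ * ‖P'' R t‖) := by
          refine (norm_add_le _ _).trans (add_le_add ?_ ?_) <;>
            exact (norm_add_le _ _).trans (by rw [norm_mul, norm_mul])
      _ ≤ (C * Real.exp (-(b₀ * |t|)) * 1 + C * Real.exp (-(b₀ * |t|)) * D₁) +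
          (C * Real.exp (-(b₀ * |t|)) * D₁ + C * Real.exp (-(b₀ * |t|)) * D₂) :=
          add_le_add
            (add_le_add (mul_le_mul (h2 t) (nP R t) (norm_nonneg _) e)
              (mul_le_mul (h1 t) (nP' R t) (norm_nonneg _) e))
            (add_le_add (mul_le_mul (h1 t) (nP' R t) (norm_nonneg _) e)
              (mul_le_mul (h0 t) (nP'' R t) (norm_nonneg _) e))
      _ = K * Real.exp (-(b₀ * |t|)) := by rw [hK]; ring
  -- vanishing on the plateau `|t| < R - 1`, continuity
  have zH : ∀ R t, |t| < R - 1 → H R t = 0 := fun R t ht => by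
    simp [hH, hP, cutoff_eq_one ht.le]
  have zH'' : ∀ R t, |t| < R - 1 → H'' R t = 0 := fun R t ht => by
    simp [hH'', hP, hP', hP'', cutoff_eq_one ht.le, deriv_cutoff_eq_zero_of_lt ht,
      deriv_deriv_cutoff_eq_zero_of_lt ht]
  have cH : ∀ R, Continuous (H R) := fun R => by
    have h₁ := cχ R
    simp only [hH, hP]
    fun_prop
  have cH'' : ∀ R, Continuous (H'' R) := fun R => by
    have h₁ := cχ R
    have h₂ := cχ' R
    have h₃ := cχ'' R
    simp only [hH'', hP, hP', hP'']
    fun_prop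
  -- the weighted tail norms tend to `0`
  have hτ₀ := zsTrunc_tendsto_integral_norm_mul_exp cH hb bH zH
  have hτ₂ := zsTrunc_tendsto_integral_norm_mul_exp cH'' hb bH'' zH''
  refine ⟨fun R => 2 * ((∫ t : ℝ, ‖H R t‖ * Real.exp (|t| / 2)) +
      ∫ t : ℝ, ‖H'' R t‖ * Real.exp (|t| / 2)), ?_, fun R s hs0 hs1 => ?_⟩
  · simpa using (hτ₀.add hτ₂).const_mul 2
  · rw [zsTrunc_weilMellin_sub hfc hb h0 R hs0 hs1]
    exact zsTrunc_norm_weilMellin_le (hHd R) (hHd' R) (cH'' R) hb (bH R) (bH' R) (bH'' R) hs0 hs1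

end Tail

/-! ## The stub -/

/-- **Stub W12a — `zeroSide_truncation` (RH-free).**  For `f` in the exponential Weil class
(`f` smooth, `‖f‖, ‖f'‖, ‖f''‖ ≤ C e^{-b₀|t|}`, `b₀ > 1/2`) the zero side of the explicit formula
converges absolutely, `Σ_ρ ‖m(ρ) f̂(ρ)‖ < ∞` over the non-trivial zeros, and the zero sides of the
plateau truncations `f_R = f · χ_R` converge to it: `Σ'_ρ m(ρ) f̂_R(ρ) → Σ'_ρ m(ρ) f̂(ρ)` as
`R → ∞` (`‖f̂(ρ) − f̂_R(ρ)‖ ≤ τ(R)/(1 + γ²)` with `τ(R) → 0`, and `Σ_ρ m(ρ)/(1 + γ²) < ∞`).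
[folklore] -/
theorem stub_zeroSide_truncation :
    ∀ (f : ℝ → ℂ) (C b₀ : ℝ), ContDiff ℝ (⊤ : ℕ∞) f → 1 / 2 < b₀ →
      (∀ t, ‖f t‖ ≤ C * Real.exp (-(b₀ * |t|))) →
      (∀ t, ‖deriv f t‖ ≤ C * Real.exp (-(b₀ * |t|))) →
      (∀ t, ‖deriv (deriv f) t‖ ≤ C * Real.exp (-(b₀ * |t|))) →
      Summable (fun ρ : ZetaZeros.riemannZetaNontrivialZeros =>
          ‖(riemannZetaZeroOrder (ρ : ℂ) : ℂ) * weilMellin f ρ‖) ∧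
      Tendsto (fun R : ℝ => ∑' ρ : ZetaZeros.riemannZetaNontrivialZeros,
          (riemannZetaZeroOrder (ρ : ℂ) : ℂ) *
            weilMellin (fun t : ℝ => f t * ((Literature.Analysis.Calculus.cutoff R t : ℝ) : ℂ)) ρ)
        atTop
        (𝓝 (∑' ρ : ZetaZeros.riemannZetaNontrivialZeros,
          (riemannZetaZeroOrder (ρ : ℂ) : ℂ) * weilMellin f ρ)) := by
  intro f C b₀ hf hb h0 h1 h2
  -- two derivatives of `f`
  have hdf : Differentiable ℝ f := (contDiff_infty_iff_deriv.mp hf).1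
  have hf' : ContDiff ℝ (⊤ : ℕ∞) (deriv f) := (contDiff_infty_iff_deriv.mp hf).2
  have hdf' : Differentiable ℝ (deriv f) := (contDiff_infty_iff_deriv.mp hf').1
  have hc'' : Continuous (deriv (deriv f)) := (contDiff_infty_iff_deriv.mp hf').2.continuous
  have hd : ∀ t, HasDerivAt f (deriv f t) t := fun t => (hdf t).hasDerivAt
  have hd' : ∀ t, HasDerivAt (deriv f) (deriv (deriv f) t) t := fun t => (hdf' t).hasDerivAt
  -- absolute convergence of the zero side for `f`
  have hA : ∀ s : ℂ, 0 ≤ s.re → s.re ≤ 1 → ‖weilMellin f s‖ ≤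
      2 * ((∫ t : ℝ, ‖f t‖ * Real.exp (|t| / 2)) +
        ∫ t : ℝ, ‖deriv (deriv f) t‖ * Real.exp (|t| / 2)) / (1 + s.im ^ 2) :=
    fun s hs0 hs1 => zsTrunc_norm_weilMellin_le hd hd' hc'' hb h0 h1 h2 hs0 hs1
  obtain ⟨hS, -⟩ := zsTrunc_summable_of_le (a := weilMellin f) hA
  refine ⟨hS, ?_⟩
  -- convergence of the truncated zero sides
  obtain ⟨τ, hτ, hτb⟩ := zsTrunc_tail_control hb hd hd' hc'' h0 h1 h2
  set Z : ℝ := ∑' ρ : ZetaZeros.riemannZetaNontrivialZeros,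
    (riemannZetaZeroOrder (ρ : ℂ) : ℝ) / (1 + (ρ : ℂ).im ^ 2) with hZ
  have hS' : Summable fun ρ : ZetaZeros.riemannZetaNontrivialZeros =>
      (riemannZetaZeroOrder (ρ : ℂ) : ℂ) * weilMellin f ρ := hS.of_norm
  rw [tendsto_iff_norm_sub_tendsto_zero]
  refine squeeze_zero (fun R => norm_nonneg _) (fun R => ?_)
    (show Tendsto (fun R => τ R * Z) atTop (𝓝 0) by simpa using hτ.mul_const Z)
  set fR : ℝ → ℂ := fun t : ℝ => f t * ((Literature.Analysis.Calculus.cutoff R t : ℝ) : ℂ) with hfR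
  -- `Σ ‖m(ρ)(f̂(ρ) - f̂_R(ρ))‖ ≤ τ(R) Z`
  obtain ⟨hDn, hDle⟩ := zsTrunc_summable_of_le (a := fun s => weilMellin f s - weilMellin fR s)
    (fun s hs0 hs1 => hτb R s hs0 hs1)
  have hD' : Summable fun ρ : ZetaZeros.riemannZetaNontrivialZeros =>
      (riemannZetaZeroOrder (ρ : ℂ) : ℂ) * (weilMellin f ρ - weilMellin fR ρ) := hDn.of_norm
  have hSR' : Summable fun ρ : ZetaZeros.riemannZetaNontrivialZeros =>
      (riemannZetaZeroOrder (ρ : ℂ) : ℂ) * weilMellin fR ρ :=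
    (hS'.sub hD').congr fun ρ => by ring
  have hdiff : (∑' ρ : ZetaZeros.riemannZetaNontrivialZeros,
      (riemannZetaZeroOrder (ρ : ℂ) : ℂ) * weilMellin fR ρ) -
      (∑' ρ : ZetaZeros.riemannZetaNontrivialZeros,
        (riemannZetaZeroOrder (ρ : ℂ) : ℂ) * weilMellin f ρ) =
      -∑' ρ : ZetaZeros.riemannZetaNontrivialZeros,
        (riemannZetaZeroOrder (ρ : ℂ) : ℂ) * (weilMellin f ρ - weilMellin fR ρ) := by
    rw [← hSR'.tsum_sub hS', ← tsum_neg]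
    exact tsum_congr fun ρ => by ring
  rw [hdiff, norm_neg]
  exact (norm_tsum_le_tsum_norm hDn).trans hDle

end Summit.RiemannHypothesis.RiemannHypothesis.Theorems.GroundStatesConvergeToXi

end
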